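import Summits.NavierStokesRegularity.FluidComputer.DampedTransition

/-!
# Tao's delay gate under NON-UNIFORM diagonal damping, part 2 of 3: the quiet phase
# ((code), (dora), (able2), (bogo-2), sharp super-solution)

Companion file of `DampedTransition.lean` (cell `pub-fluidc`, seat bp1; the three files are ONE text, split
by the 400-line rule; same namespace `Summit.NavierStokesRegularity.FluidComputer.DampedTransition`).
HONEST FRAMING (verbatim): low prior, high value-of-information experiment on Tao's machine paradigm; NOT a
claim that NS blows up. Everything here concerns the five-mode truncation (5.5) of [Tao2016AveragedNS,
§5.5] (`delayCircuitWith K M ε`) with an added diagonal damping `-E(t) * X`, `0 ≤ Eᵢ(t) ≤ η`, the ODE and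
the bounds on `E` assumed on the window `[0,2]` only; nothing is proved about the Navier–Stokes equations.
Throughout, `τ ≤ 2` is a time with `c ≤ K⁻¹⁰ε²` on `[0,τ]` ((boots); in part 3 it is the hitting time).
Contents (the printed absorptions of [Tao2016AveragedNS, pp. 28–29] with `17K⁻²⁰ ↦ θ := 17K⁻²⁰ + 9η`):
* `c_crude` — (code): `c ≤ 2ε²e^{(5t-1)M}` on `[0,2]` (kept for the firing phase; not used below).
* `de_small` — (dora) verbatim: `|d|, |ã| ≤ 3K⁻¹⁰` on `[0,τ]` (the damping terms only help).
* `a_window` — (able2) becomes `|a - 1| ≤ 8K⁻²⁰ + 2η` (`|∂ₜa| ≤ 4K⁻²⁰ + η`).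
* `b_window` — (bogo-2) becomes `|b - εt| ≤ θ·εt` (`|∂ₜb - ε| ≤ 16εK⁻²⁰ + 4εη + εK⁻²⁰ + 5εη`).
* `c_upper_sharp` — the super-solution `c(t) ≤ 2ε² exp((1+θ)Mt²/2 - M)` (integrating factor
  `exp(-(1+θ)Mt²/2)`; the trigger sweeps at rate `ε⁻¹Mb - E₂ ≤ (1+θ)Mt`).

[cite: Tao2016AveragedNS, §5.5 Thm 5.3 proof (code), (dora), (able2), (bogo-2), (tcable)]
-/

noncomputable section

namespace Summit.NavierStokesRegularity.FluidComputer

open Real Set Filter Topology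
open Literature.Analysis.FluidPDE.Tao2016AveragedNS
open Literature.Analysis.FluidPDE.Tao2016AveragedNS.Thm53 (antitoneOn_intFactor monotoneOn_intFactor
  antitoneOn_sub_of_deriv_le monotoneOn_sub_of_le_deriv abs_sub_le_of_abs_deriv_le
  init_a init_b init_c init_d init_e)

namespace DampedTransition

/-! ## §2. Up to the critical time: (code), (dora), (able2), (bogo-2), the sharp super-solution for `c` -/

section PhaseOne

variable {K M ε η τ : ℝ} {E X : ℝ → Fin 5 → ℝ}

/-- (code) survives damping: `c(t) ≤ 2ε² e^{(5t-1)M}` on `[0,2]` (`∂ₜc ≤ ε²e^{-M} + 5M c` since `c ≥ 0`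
makes `-E₂c ≤ 0`). [cite: Tao2016AveragedNS, §5.5 (code)] -/
theorem c_crude
    (hX : ∀ t ∈ Icc (0:ℝ) 2, HasDerivAt X (delayCircuitWith K M ε (X t) - E t * X t) t)
    (hE : ∀ t ∈ Icc (0:ℝ) 2, ∀ i, 0 ≤ E t i ∧ E t i ≤ η) (h0 : X 0 = delayInit)
    (hε : 0 < ε) (hε1 : ε ≤ 1) (hM0 : 0 ≤ M) {t : ℝ} (ht : t ∈ Icc 0 2) :
    X t 2 ≤ 2 * ε ^ 2 * exp ((5 * t - 1) * M) := by
  set μ := ε ^ 2 * exp (-M) with hμ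
  have hμ0 : 0 ≤ μ := by positivity
  have hanti := antitoneOn_intFactor (s := Icc 0 2) (g := fun _ => 5 * M)
    (G := fun s => 5 * M * s) (φ := fun _ => μ) (Φ := fun s => μ * s) (convex_Icc 0 2)
    (fun s hs => hasDerivAt_c (hX s hs))
    (fun s _ => ((hasDerivAt_id s).const_mul (5 * M)).congr_deriv (by simp))
    (fun s _ => ((hasDerivAt_id s).const_mul μ).congr_deriv (by simp))
    (fun s hs => by
      have hc0 : 0 ≤ X s 2 := c_nonneg hX hE h0 hε hε1 hM0 hs
      have hb : |X s 1| ≤ 5 * ε := (bc_small hX hE h0 hε hε1 hM0 hs).1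
      have ha : X s 0 ^ 2 ≤ 1 := traj_sq_le_one hX hE h0 hs 0
      have hexp : exp (-(5 * M * s)) ≤ 1 := by
        rw [exp_le_one_iff, neg_nonpos]; have := hs.1; positivity
      have h1 : ε ^ 2 * exp (-M) * X s 0 ^ 2 ≤ μ := by
        simpa [hμ] using mul_le_mul_of_nonneg_left ha (by positivity : 0 ≤ ε ^ 2 * exp (-M))
      have h2 : ε⁻¹ * M * X s 1 * X s 2 ≤ 5 * M * X s 2 := by
        have hb' : X s 1 ≤ 5 * ε := (le_abs_self _).trans hb
        have h5 : ε⁻¹ * X s 1 ≤ 5 := by rw [inv_mul_le_iff₀ hε]; linarith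
        have : ε⁻¹ * M * X s 1 * X s 2 = (ε⁻¹ * X s 1) * (M * X s 2) := by ring
        rw [this]
        nlinarith [mul_nonneg hM0 hc0]
      have h3 : -(E s 2 * X s 2) ≤ 0 := by
        rw [neg_nonpos]; exact mul_nonneg (hE s hs 2).1 hc0
      have hbr : ε ^ 2 * exp (-M) * X s 0 ^ 2 + ε⁻¹ * M * X s 1 * X s 2 - E s 2 * X s 2
          - 5 * M * X s 2 ≤ μ := by linarith
      calc (ε ^ 2 * exp (-M) * X s 0 ^ 2 + ε⁻¹ * M * X s 1 * X s 2 - E s 2 * X s 2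
            - 5 * M * X s 2) * exp (-(5 * M * s))
          ≤ μ * exp (-(5 * M * s)) := mul_le_mul_of_nonneg_right hbr (exp_pos _).le
        _ ≤ μ * 1 := mul_le_mul_of_nonneg_left hexp hμ0
        _ = μ := mul_one _)
  have h0mem : (0 : ℝ) ∈ Icc (0 : ℝ) 2 := ⟨le_rfl, by norm_num⟩
  have h := hanti h0mem ht ht.1
  simp only [init_c h0, zero_mul, mul_zero, sub_zero] at h
  have h' : X t 2 * exp (-(5 * M * t)) ≤ μ * t := by linarith
  have hexp : X t 2 = X t 2 * exp (-(5 * M * t)) * exp (5 * M * t) := by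
    rw [mul_assoc, ← exp_add, neg_add_cancel, exp_zero, mul_one]
  rw [hexp]
  calc X t 2 * exp (-(5 * M * t)) * exp (5 * M * t)
      ≤ μ * t * exp (5 * M * t) := mul_le_mul_of_nonneg_right h' (exp_pos _).le
    _ ≤ μ * 2 * exp (5 * M * t) := by
        have := ht.2
        exact mul_le_mul_of_nonneg_right (mul_le_mul_of_nonneg_left this hμ0) (exp_pos _).le
    _ = 2 * ε ^ 2 * exp ((5 * t - 1) * M) := by
        simp only [hμ]
        rw [show (5 * t - 1) * M = -M + 5 * M * t by ring, exp_add]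
        ring

/-- (dora) survives damping verbatim: `|d|, |ã| ≤ 3K⁻¹⁰` on `[0,τ]`, from
`∂ₜ(d²+ã²) = 2ε⁻²c·a·d - 2E₃d² - 2E₄ã² ≤ 2ε⁻²c·a·d` applied to `√(d²+ã²+K⁻²⁰)`.
[cite: Tao2016AveragedNS, §5.5 (dora)] -/
theorem de_small
    (hX : ∀ t ∈ Icc (0:ℝ) 2, HasDerivAt X (delayCircuitWith K M ε (X t) - E t * X t) t)
    (hE : ∀ t ∈ Icc (0:ℝ) 2, ∀ i, 0 ≤ E t i ∧ E t i ≤ η) (h0 : X 0 = delayInit)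
    (hε : 0 < ε) (hε1 : ε ≤ 1) (hM0 : 0 ≤ M) (hK : 0 < K) (hτ2 : τ ≤ 2)
    (hcτ : ∀ t, 0 ≤ t → t ≤ τ → X t 2 ≤ ε ^ 2 / K ^ 10)
    {t : ℝ} (ht : t ∈ Icc 0 τ) : |X t 3| ≤ 3 / K ^ 10 ∧ |X t 4| ≤ 3 / K ^ 10 := by
  set κ : ℝ := (K ^ 10)⁻¹ with hκ
  have hκ0 : 0 < κ := by positivity
  set u : ℝ → ℝ := fun s => X s 3 ^ 2 + X s 4 ^ 2 with hu
  set h : ℝ → ℝ := fun s => sqrt (u s + κ ^ 2) with hh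
  have hupos : ∀ s, 0 < u s + κ ^ 2 := fun s => by positivity
  have hd_le : ∀ s, |X s 3| ≤ h s := fun s =>
    abs_le_sqrt (by simp only [hu]; nlinarith [sq_nonneg (X s 4)])
  have he_le : ∀ s, |X s 4| ≤ h s := fun s =>
    abs_le_sqrt (by simp only [hu]; nlinarith [sq_nonneg (X s 3)])
  have hder : ∀ s ∈ Icc (0:ℝ) 2, HasDerivAt h
      ((2 * (ε ^ 2)⁻¹ * X s 2 * X s 0 * X s 3 - 2 * E s 3 * X s 3 ^ 2 - 2 * E s 4 * X s 4 ^ 2)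
        / (2 * sqrt (u s + κ ^ 2))) s := fun s hs =>
    ((out_energy (hX s hs)).add_const (κ ^ 2)).sqrt (hupos s).ne'
  have hbound : ∀ s ∈ Icc 0 τ,
      (2 * (ε ^ 2)⁻¹ * X s 2 * X s 0 * X s 3 - 2 * E s 3 * X s 3 ^ 2 - 2 * E s 4 * X s 4 ^ 2)
        / (2 * sqrt (u s + κ ^ 2)) ≤ κ := by
    intro s hs
    have hs2 : s ∈ Icc (0 : ℝ) 2 := ⟨hs.1, hs.2.trans hτ2⟩
    have hhpos : 0 < sqrt (u s + κ ^ 2) := sqrt_pos.2 (hupos s)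
    rw [div_le_iff₀ (by positivity)]
    have hc0 : 0 ≤ X s 2 := c_nonneg hX hE h0 hε hε1 hM0 hs2
    have hcθ : X s 2 ≤ ε ^ 2 / K ^ 10 := hcτ s hs.1 hs.2
    have ha : |X s 0| ≤ 1 := traj_abs_le_one hX hE h0 hs2 0
    have hds : |X s 3| ≤ h s := hd_le s
    have hh' : h s = sqrt (u s + κ ^ 2) := rfl
    rw [← hh']
    have h1 : |X s 0 * X s 3| ≤ h s := by
      rw [abs_mul]
      calc |X s 0| * |X s 3| ≤ 1 * h s := mul_le_mul ha hds (abs_nonneg _) zero_le_one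
        _ = h s := one_mul _
    have h2 : (ε ^ 2)⁻¹ * X s 2 ≤ κ := by
      calc (ε ^ 2)⁻¹ * X s 2 ≤ (ε ^ 2)⁻¹ * (ε ^ 2 / K ^ 10) :=
            mul_le_mul_of_nonneg_left hcθ (by positivity)
        _ = κ := by simp only [hκ]; field_simp
    have h3 : 0 ≤ (ε ^ 2)⁻¹ * X s 2 := by positivity
    have h4 : (ε ^ 2)⁻¹ * X s 2 * (X s 0 * X s 3) ≤ κ * h s :=
      calc (ε ^ 2)⁻¹ * X s 2 * (X s 0 * X s 3) ≤ (ε ^ 2)⁻¹ * X s 2 * |X s 0 * X s 3| :=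
            mul_le_mul_of_nonneg_left (le_abs_self _) h3
        _ ≤ κ * h s := mul_le_mul h2 h1 (abs_nonneg _) hκ0.le
    have hD : 0 ≤ 2 * E s 3 * X s 3 ^ 2 + 2 * E s 4 * X s 4 ^ 2 := by
      have := (hE s hs2 3).1; have := (hE s hs2 4).1; positivity
    have : 2 * (ε ^ 2)⁻¹ * X s 2 * X s 0 * X s 3 = 2 * ((ε ^ 2)⁻¹ * X s 2 * (X s 0 * X s 3)) := by
      ring
    rw [this]
    linarith
  have hanti := antitoneOn_sub_of_deriv_le (Φ := fun s => κ * s) (convex_Icc 0 τ)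
    (fun s hs => hder s ⟨hs.1, hs.2.trans hτ2⟩)
    (fun s _ => ((hasDerivAt_id s).const_mul κ).congr_deriv (by simp)) hbound
  have h0mem : (0 : ℝ) ∈ Icc (0 : ℝ) τ := ⟨le_rfl, ht.1.trans ht.2⟩
  have hmono := hanti h0mem ht ht.1
  have hh0 : h 0 = κ := by
    simp only [hh, hu, init_d h0, init_e h0]
    simpa using sqrt_sq hκ0.le
  simp only [hh0, mul_zero, sub_zero] at hmono
  have hht : h t ≤ 3 / K ^ 10 := by
    have ht2 : t ≤ 2 := ht.2.trans hτ2
    have : h t ≤ κ + κ * t := by linarith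
    calc h t ≤ κ + κ * t := this
      _ ≤ κ + κ * 2 := by nlinarith
      _ = 3 / K ^ 10 := by simp only [hκ]; ring
  exact ⟨(hd_le t).trans hht, (he_le t).trans hht⟩

/-- (able2) under damping: `|a - 1| ≤ 8K⁻²⁰ + 2η` on `[0,τ]` (from `∂ₜa = O(K⁻²⁰) + O(ε²) - E₀a`,
`|E₀a| ≤ η`). [cite: Tao2016AveragedNS, §5.5 (able2)] -/
theorem a_window
    (hX : ∀ t ∈ Icc (0:ℝ) 2, HasDerivAt X (delayCircuitWith K M ε (X t) - E t * X t) t)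
    (hE : ∀ t ∈ Icc (0:ℝ) 2, ∀ i, 0 ≤ E t i ∧ E t i ≤ η) (h0 : X 0 = delayInit)
    (hε : 0 < ε) (hε1 : ε ≤ 1) (hM0 : 0 ≤ M) (hK : 0 < K) (hτ2 : τ ≤ 2)
    (hεK : ε ^ 2 ≤ 1 / (6 * K ^ 20))
    (hcτ : ∀ t, 0 ≤ t → t ≤ τ → X t 2 ≤ ε ^ 2 / K ^ 10)
    {t : ℝ} (ht : t ∈ Icc 0 τ) : |X t 0 - 1| ≤ 8 / K ^ 20 + 2 * η := by
  have hη0 : 0 ≤ η := (hE 0 ⟨le_rfl, zero_le_two⟩ 0).1.trans (hE 0 ⟨le_rfl, zero_le_two⟩ 0).2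
  have hM : ∀ s ∈ Icc 0 τ, |(-((ε ^ 2)⁻¹ * X s 2 * X s 3) - ε * X s 0 * X s 1
      - ε ^ 2 * exp (-M) * X s 0 * X s 2 - E s 0 * X s 0)| ≤ 4 / K ^ 20 + η := by
    intro s hs
    have hs2 : s ∈ Icc (0 : ℝ) 2 := ⟨hs.1, hs.2.trans hτ2⟩
    have hc0 : 0 ≤ X s 2 := c_nonneg hX hE h0 hε hε1 hM0 hs2
    have hcθ : X s 2 ≤ ε ^ 2 / K ^ 10 := hcτ s hs.1 hs.2
    have hd : |X s 3| ≤ 3 / K ^ 10 := (de_small hX hE h0 hε hε1 hM0 hK hτ2 hcτ hs).1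
    have ha : |X s 0| ≤ 1 := traj_abs_le_one hX hE h0 hs2 0
    have hb : |X s 1| ≤ 5 * ε := (bc_small hX hE h0 hε hε1 hM0 hs2).1
    have hc1 : |X s 2| ≤ 1 := traj_abs_le_one hX hE h0 hs2 2
    have hek : exp (-M) ≤ 1 := by rw [exp_le_one_iff, neg_nonpos]; exact hM0
    -- term 1: `|ρ c d| ≤ 3 K⁻²⁰`
    have h1 : |(ε ^ 2)⁻¹ * X s 2 * X s 3| ≤ 3 / K ^ 20 := by
      rw [abs_mul, abs_of_nonneg (by positivity : 0 ≤ (ε ^ 2)⁻¹ * X s 2)]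
      calc (ε ^ 2)⁻¹ * X s 2 * |X s 3| ≤ (ε ^ 2)⁻¹ * (ε ^ 2 / K ^ 10) * (3 / K ^ 10) :=
            mul_le_mul (mul_le_mul_of_nonneg_left hcθ (by positivity)) hd (abs_nonneg _)
              (by positivity)
        _ = 3 / K ^ 20 := by field_simp
    -- term 2: `|ε a b| ≤ 5ε²`
    have h2 : |ε * X s 0 * X s 1| ≤ 5 * ε ^ 2 := by
      rw [abs_mul, abs_mul, abs_of_pos hε]
      calc ε * |X s 0| * |X s 1| ≤ ε * 1 * (5 * ε) :=
            mul_le_mul (mul_le_mul_of_nonneg_left ha hε.le) hb (abs_nonneg _) (by positivity)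
        _ = 5 * ε ^ 2 := by ring
    -- term 3: `|μ a c| ≤ ε²`
    have h3 : |ε ^ 2 * exp (-M) * X s 0 * X s 2| ≤ ε ^ 2 := by
      rw [abs_mul, abs_mul, abs_mul, abs_of_pos (pow_pos hε 2), abs_of_pos (exp_pos _)]
      calc ε ^ 2 * exp (-M) * |X s 0| * |X s 2| ≤ ε ^ 2 * 1 * 1 * 1 :=
            mul_le_mul (mul_le_mul (mul_le_mul_of_nonneg_left hek (by positivity)) ha
              (abs_nonneg _) (by positivity)) hc1 (abs_nonneg _) (by positivity)
        _ = ε ^ 2 := by ring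
    -- term 4 (damping): `|E₀ a| ≤ η`
    have h4 : |E s 0 * X s 0| ≤ η := by
      rw [abs_mul, abs_of_nonneg (hE s hs2 0).1]
      calc E s 0 * |X s 0| ≤ η * 1 := mul_le_mul (hE s hs2 0).2 ha (abs_nonneg _) hη0
        _ = η := mul_one _
    have h6 : 6 * ε ^ 2 ≤ 1 / K ^ 20 := by
      have := hεK
      rw [le_div_iff₀ (by positivity)] at this
      rw [le_div_iff₀ (by positivity)]
      linarith
    have hA : |(-((ε ^ 2)⁻¹ * X s 2 * X s 3) - ε * X s 0 * X s 1 - ε ^ 2 * exp (-M) * X s 0 * X s 2)|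
        ≤ 3 / K ^ 20 + 5 * ε ^ 2 + ε ^ 2 := by
      calc |(-((ε ^ 2)⁻¹ * X s 2 * X s 3) - ε * X s 0 * X s 1 - ε ^ 2 * exp (-M) * X s 0 * X s 2)|
          ≤ |(-((ε ^ 2)⁻¹ * X s 2 * X s 3) - ε * X s 0 * X s 1)|
            + |ε ^ 2 * exp (-M) * X s 0 * X s 2| := abs_sub _ _
        _ ≤ |(-((ε ^ 2)⁻¹ * X s 2 * X s 3))| + |ε * X s 0 * X s 1|
            + |ε ^ 2 * exp (-M) * X s 0 * X s 2| := by
            have := abs_sub (-((ε ^ 2)⁻¹ * X s 2 * X s 3)) (ε * X s 0 * X s 1)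
            linarith
        _ ≤ 3 / K ^ 20 + 5 * ε ^ 2 + ε ^ 2 := by rw [abs_neg]; linarith
    calc |(-((ε ^ 2)⁻¹ * X s 2 * X s 3) - ε * X s 0 * X s 1 - ε ^ 2 * exp (-M) * X s 0 * X s 2
          - E s 0 * X s 0)|
        ≤ |(-((ε ^ 2)⁻¹ * X s 2 * X s 3) - ε * X s 0 * X s 1 - ε ^ 2 * exp (-M) * X s 0 * X s 2)|
          + |E s 0 * X s 0| := abs_sub _ _
      _ ≤ 3 / K ^ 20 + 5 * ε ^ 2 + ε ^ 2 + η := by linarith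
      _ ≤ 4 / K ^ 20 + η := by
          have : 3 / K ^ 20 + 6 * ε ^ 2 ≤ 3 / K ^ 20 + 1 / K ^ 20 := by linarith
          calc 3 / K ^ 20 + 5 * ε ^ 2 + ε ^ 2 + η = 3 / K ^ 20 + 6 * ε ^ 2 + η := by ring
            _ ≤ 3 / K ^ 20 + 1 / K ^ 20 + η := by linarith
            _ = 4 / K ^ 20 + η := by ring
  have := abs_sub_le_of_abs_deriv_le
    (fun s hs => hasDerivAt_a (hX s ⟨hs.1, hs.2.trans hτ2⟩)) hM ht
  rw [init_a h0, sub_zero] at this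
  calc |X t 0 - 1| ≤ (4 / K ^ 20 + η) * t := this
    _ ≤ (4 / K ^ 20 + η) * 2 := by
        have : t ≤ 2 := ht.2.trans hτ2
        exact mul_le_mul_of_nonneg_left this (by positivity)
    _ = 8 / K ^ 20 + 2 * η := by ring

/-- (bogo-2) under damping: `|b - εt| ≤ (17K⁻²⁰ + 9η)·εt` on `[0,τ]` (from
`∂ₜb - ε = ε(a² - 1) - ε⁻¹Mc² - E₁b`, `|E₁b| ≤ 5εη` by (ob-2)). [cite: Tao2016AveragedNS, §5.5 (bogo-2)] -/
theorem b_window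
    (hX : ∀ t ∈ Icc (0:ℝ) 2, HasDerivAt X (delayCircuitWith K M ε (X t) - E t * X t) t)
    (hE : ∀ t ∈ Icc (0:ℝ) 2, ∀ i, 0 ≤ E t i ∧ E t i ≤ η) (h0 : X 0 = delayInit)
    (hε : 0 < ε) (hε1 : ε ≤ 1) (hM0 : 0 < M) (hMK : M ≤ K ^ 10) (hK : 1 ≤ K) (hτ2 : τ ≤ 2)
    (hεK : ε ^ 2 ≤ 1 / (6 * K ^ 20))
    (hcτ : ∀ t, 0 ≤ t → t ≤ τ → X t 2 ≤ ε ^ 2 / K ^ 10)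
    {t : ℝ} (ht : t ∈ Icc 0 τ) : |X t 1 - ε * t| ≤ (17 / K ^ 20 + 9 * η) * ε * t := by
  have hK0 : 0 < K := by linarith
  have hη0 : 0 ≤ η := (hE 0 ⟨le_rfl, zero_le_two⟩ 0).1.trans (hE 0 ⟨le_rfl, zero_le_two⟩ 0).2
  have hM : ∀ s ∈ Icc 0 τ,
      |ε * X s 0 ^ 2 - ε⁻¹ * M * X s 2 ^ 2 - E s 1 * X s 1 - ε * 1| ≤ (17 / K ^ 20 + 9 * η) * ε := by
    intro s hs
    have hs2 : s ∈ Icc (0 : ℝ) 2 := ⟨hs.1, hs.2.trans hτ2⟩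
    have hc0 : 0 ≤ X s 2 := c_nonneg hX hE h0 hε hε1 hM0.le hs2
    have hcθ : X s 2 ≤ ε ^ 2 / K ^ 10 := hcτ s hs.1 hs.2
    have ha1 : |X s 0 - 1| ≤ 8 / K ^ 20 + 2 * η :=
      a_window hX hE h0 hε hε1 hM0.le hK0 hτ2 hεK hcτ hs
    have ha : |X s 0| ≤ 1 := traj_abs_le_one hX hE h0 hs2 0
    have hb : |X s 1| ≤ 5 * ε := (bc_small hX hE h0 hε hε1 hM0.le hs2).1
    -- `|ε (a² - 1)| ≤ (16 K⁻²⁰ + 4η) ε`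
    have h1 : |ε * (X s 0 ^ 2 - 1)| ≤ (16 / K ^ 20 + 4 * η) * ε := by
      rw [abs_mul, abs_of_pos hε, show X s 0 ^ 2 - 1 = (X s 0 - 1) * (X s 0 + 1) by ring, abs_mul]
      have hp1 : |X s 0 + 1| ≤ 2 := by
        calc |X s 0 + 1| ≤ |X s 0| + |1| := abs_add_le _ _
          _ ≤ 1 + 1 := by rw [abs_one]; linarith
          _ = 2 := by norm_num
      calc ε * (|X s 0 - 1| * |X s 0 + 1|) ≤ ε * ((8 / K ^ 20 + 2 * η) * 2) :=
            mul_le_mul_of_nonneg_left (mul_le_mul ha1 hp1 (abs_nonneg _) (by positivity)) hε.le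
        _ = (16 / K ^ 20 + 4 * η) * ε := by ring
    -- `0 ≤ ν c² ≤ ε K⁻²⁰`
    have h2 : 0 ≤ ε⁻¹ * M * X s 2 ^ 2 := by
      have := hM0.le
      positivity
    have h3 : ε⁻¹ * M * X s 2 ^ 2 ≤ ε / K ^ 20 := by
      have hc2 : X s 2 ^ 2 ≤ (ε ^ 2 / K ^ 10) ^ 2 := pow_le_pow_left₀ hc0 hcθ 2
      have hMε : M * ε ^ 2 ≤ 1 := by
        calc M * ε ^ 2 ≤ K ^ 10 * (1 / (6 * K ^ 20)) :=
              mul_le_mul hMK hεK (by positivity) (by positivity)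
          _ = K ^ 10 / K ^ 20 / 6 := by field_simp
          _ ≤ 1 / 1 / 6 := by
              have : K ^ 10 / K ^ 20 ≤ 1 := by
                rw [div_le_one (by positivity)]
                exact pow_le_pow_right₀ hK (by norm_num)
              linarith
          _ ≤ 1 := by norm_num
      calc ε⁻¹ * M * X s 2 ^ 2 ≤ ε⁻¹ * M * (ε ^ 2 / K ^ 10) ^ 2 :=
            mul_le_mul_of_nonneg_left hc2 (by have := hM0.le; positivity)
        _ = ε * (M * ε ^ 2) / K ^ 20 := by field_simp
        _ ≤ ε * 1 / K ^ 20 := by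
            exact div_le_div_of_nonneg_right (mul_le_mul_of_nonneg_left hMε hε.le) (by positivity)
        _ = ε / K ^ 20 := by ring
    -- damping: `|E₁ b| ≤ 5εη`
    have h4 : |E s 1 * X s 1| ≤ 5 * η * ε := by
      rw [abs_mul, abs_of_nonneg (hE s hs2 1).1]
      calc E s 1 * |X s 1| ≤ η * (5 * ε) := mul_le_mul (hE s hs2 1).2 hb (abs_nonneg _) hη0
        _ = 5 * η * ε := by ring
    rw [show ε * X s 0 ^ 2 - ε⁻¹ * M * X s 2 ^ 2 - E s 1 * X s 1 - ε * 1
        = (ε * (X s 0 ^ 2 - 1) - ε⁻¹ * M * X s 2 ^ 2) - E s 1 * X s 1 by ring]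
    calc |(ε * (X s 0 ^ 2 - 1) - ε⁻¹ * M * X s 2 ^ 2) - E s 1 * X s 1|
        ≤ |ε * (X s 0 ^ 2 - 1) - ε⁻¹ * M * X s 2 ^ 2| + |E s 1 * X s 1| := abs_sub _ _
      _ ≤ |ε * (X s 0 ^ 2 - 1)| + |ε⁻¹ * M * X s 2 ^ 2| + |E s 1 * X s 1| := by
          have := abs_sub (ε * (X s 0 ^ 2 - 1)) (ε⁻¹ * M * X s 2 ^ 2); linarith
      _ ≤ (16 / K ^ 20 + 4 * η) * ε + ε / K ^ 20 + 5 * η * ε := by rw [abs_of_nonneg h2]; linarith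
      _ = (17 / K ^ 20 + 9 * η) * ε := by ring
  have hder : ∀ s ∈ Icc 0 τ, HasDerivAt (fun r => X r 1 - ε * r)
      (ε * X s 0 ^ 2 - ε⁻¹ * M * X s 2 ^ 2 - E s 1 * X s 1 - ε * 1) s := fun s hs =>
    (hasDerivAt_b (hX s ⟨hs.1, hs.2.trans hτ2⟩)).sub ((hasDerivAt_id s).const_mul ε)
  have := abs_sub_le_of_abs_deriv_le hder hM ht
  simpa [init_b h0, mul_assoc] using this

/-- Sharp super-solution for `c` on `[0,τ]` under damping: `c(t) ≤ 2ε² exp((1+θ)Mt²/2 - M)`,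
`θ = 17K⁻²⁰ + 9η` (integrating factor `exp(-(1+θ)Mt²/2)`: `ε⁻¹Mb ≤ (1+θ)Mt` by `b_window`, and
`-E₂c ≤ 0`). [cite: Tao2016AveragedNS, §5.5 proof of (tcable)] -/
theorem c_upper_sharp
    (hX : ∀ t ∈ Icc (0:ℝ) 2, HasDerivAt X (delayCircuitWith K M ε (X t) - E t * X t) t)
    (hE : ∀ t ∈ Icc (0:ℝ) 2, ∀ i, 0 ≤ E t i ∧ E t i ≤ η) (h0 : X 0 = delayInit)
    (hε : 0 < ε) (hε1 : ε ≤ 1) (hM0 : 0 < M) (hMK : M ≤ K ^ 10) (hK : 1 ≤ K) (hτ2 : τ ≤ 2)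
    (hεK : ε ^ 2 ≤ 1 / (6 * K ^ 20))
    (hcτ : ∀ t, 0 ≤ t → t ≤ τ → X t 2 ≤ ε ^ 2 / K ^ 10)
    {t : ℝ} (ht : t ∈ Icc 0 τ) :
    X t 2 ≤ 2 * ε ^ 2 * exp ((1 + (17 / K ^ 20 + 9 * η)) * M * t ^ 2 / 2 - M) := by
  have hK0 : 0 < K := by linarith
  have hη0 : 0 ≤ η := (hE 0 ⟨le_rfl, zero_le_two⟩ 0).1.trans (hE 0 ⟨le_rfl, zero_le_two⟩ 0).2
  set θ : ℝ := 17 / K ^ 20 + 9 * η with hθ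
  have hθ0 : 0 ≤ θ := by positivity
  set k : ℝ := (1 + θ) * M with hk
  have hk0 : 0 < k := by positivity
  set μ : ℝ := ε ^ 2 * exp (-M) with hμ
  have hμ0 : 0 ≤ μ := by positivity
  -- integrating factor `G(s) = k s²/2`
  have hG : ∀ s, HasDerivAt (fun r : ℝ => k / 2 * (r * r)) (k * s) s := by
    intro s
    have := ((hasDerivAt_id s).mul (hasDerivAt_id s)).const_mul (k / 2)
    exact this.congr_deriv (by simp; ring)
  have hanti := antitoneOn_intFactor (s := Icc 0 τ) (g := fun s => k * s)
    (G := fun r => k / 2 * (r * r)) (φ := fun _ => μ) (Φ := fun s => μ * s)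
    (convex_Icc 0 τ) (fun s hs => hasDerivAt_c (hX s ⟨hs.1, hs.2.trans hτ2⟩)) (fun s _ => hG s)
    (fun s _ => ((hasDerivAt_id s).const_mul μ).congr_deriv (by simp))
    (fun s hs => by
      have hs2 : s ∈ Icc (0 : ℝ) 2 := ⟨hs.1, hs.2.trans hτ2⟩
      have hc0 : 0 ≤ X s 2 := c_nonneg hX hE h0 hε hε1 hM0.le hs2
      have ha : X s 0 ^ 2 ≤ 1 := traj_sq_le_one hX hE h0 hs2 0
      have hb : |X s 1 - ε * s| ≤ (17 / K ^ 20 + 9 * η) * ε * s :=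
        b_window hX hE h0 hε hε1 hM0 hMK hK hτ2 hεK hcτ hs
      -- `ν b ≤ k s`
      have hνb : ε⁻¹ * M * X s 1 ≤ k * s := by
        have hb' : X s 1 ≤ ε * s + θ * ε * s := by
          have := (abs_le.1 hb).2; simp only [hθ]; linarith
        calc ε⁻¹ * M * X s 1 ≤ ε⁻¹ * M * (ε * s + θ * ε * s) :=
              mul_le_mul_of_nonneg_left hb' (by have := hM0.le; positivity)
          _ = k * s := by simp only [hk]; field_simp
      have hexp : exp (-(k / 2 * (s * s))) ≤ 1 := by
        rw [exp_le_one_iff, neg_nonpos]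
        exact mul_nonneg (by positivity) (mul_self_nonneg s)
      have hbr : ε ^ 2 * exp (-M) * X s 0 ^ 2 + ε⁻¹ * M * X s 1 * X s 2 - E s 2 * X s 2
          - k * s * X s 2 ≤ μ := by
        have h1 : ε ^ 2 * exp (-M) * X s 0 ^ 2 ≤ μ := by
          simpa [hμ] using mul_le_mul_of_nonneg_left ha (by positivity : 0 ≤ ε ^ 2 * exp (-M))
        have h2 : ε⁻¹ * M * X s 1 * X s 2 ≤ k * s * X s 2 := mul_le_mul_of_nonneg_right hνb hc0
        have h3 : 0 ≤ E s 2 * X s 2 := mul_nonneg (hE s hs2 2).1 hc0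
        linarith
      calc (ε ^ 2 * exp (-M) * X s 0 ^ 2 + ε⁻¹ * M * X s 1 * X s 2 - E s 2 * X s 2
            - k * s * X s 2) * exp (-(k / 2 * (s * s)))
          ≤ μ * exp (-(k / 2 * (s * s))) := mul_le_mul_of_nonneg_right hbr (exp_pos _).le
        _ ≤ μ * 1 := mul_le_mul_of_nonneg_left hexp hμ0
        _ = μ := mul_one _)
  have h0mem : (0 : ℝ) ∈ Icc (0 : ℝ) τ := ⟨le_rfl, ht.1.trans ht.2⟩
  have h := hanti h0mem ht ht.1
  simp only [init_c h0, zero_mul, mul_zero, sub_zero] at h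
  have h' : X t 2 * exp (-(k / 2 * (t * t))) ≤ μ * t := by linarith
  have ht2 : t ≤ 2 := ht.2.trans hτ2
  have hEq : X t 2 = X t 2 * exp (-(k / 2 * (t * t))) * exp (k / 2 * (t * t)) := by
    rw [mul_assoc, ← exp_add, neg_add_cancel, exp_zero, mul_one]
  rw [hEq]
  calc X t 2 * exp (-(k / 2 * (t * t))) * exp (k / 2 * (t * t))
      ≤ μ * t * exp (k / 2 * (t * t)) := mul_le_mul_of_nonneg_right h' (exp_pos _).le
    _ ≤ μ * 2 * exp (k / 2 * (t * t)) :=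
        mul_le_mul_of_nonneg_right (mul_le_mul_of_nonneg_left ht2 hμ0) (exp_pos _).le
    _ = 2 * ε ^ 2 * exp ((1 + (17 / K ^ 20 + 9 * η)) * M * t ^ 2 / 2 - M) := by
        simp only [hμ, hk, hθ]
        rw [show (1 + (17 / K ^ 20 + 9 * η)) * M * t ^ 2 / 2 - M
            = -M + (1 + (17 / K ^ 20 + 9 * η)) * M / 2 * (t * t) by ring, exp_add (-M)]
        ring

end PhaseOne

end DampedTransition

end Summit.NavierStokesRegularity.FluidComputer
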